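import Literature.Barriers.CriticalPhenomena.SAPSectionLines
import HarnessLib

/-!
# Crossing parity for section lines; Rechnitzer's Lemma 10 proved (haruspicy, layer 7)

Companion of `SAPSectionLines` (A. Rechnitzer, *Haruspicy 2*, J. Combin. Theory Ser. A 113
(2006); arXiv:math/0406450v2, §2), which defines the sections of a polygon word and vendors
**Lemma 10** — "Hence no polygon with fewer than `6k-4` vertical bonds may contain a
`k`-section" — as the named fact `Rechnitzer2006_lem10`. This file DISCHARGES it
(`Rechnitzer2006_lem10_holds`), along the printed proof:

"Consider a vertical line drawn through a `k`-section … there are `k+1` segments of the line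
that lie outside the polygon and `k` segments that lie inside the polygon … to the left of any
inside gap there must be at least 1 vertical bond. Similarly … to the right … Now draw a
horizontal line through one of the other outside gaps … If no vertical bonds are crossed then a
section line may be drawn from the left into the outside gap. This splits the `k`-section into
two smaller sections … Hence we must cross at least 1 vertical bond … If we cross only a single
vertical bond before reaching the gap then the gap would lie inside the polygon. Hence we must
cross at least 2 (or any even number) vertical bonds … there must be at least
`k×1 + 2×0 + 2×(k-1) = 3k-2` vertical bonds to its left and `3k-2` vertical bonds to its right."

The one topological input — inside/outside and "any even number" — is the **crossing parity**
of a closed lattice walk with respect to a quadrant (`even_card_hBelow_add_card_vLeft`,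
`even_card_hBelow_add_card_vRight`): the number of horizontal letters across the gap `g` at
heights `≤ j` plus the number of vertical letters of row `j` in columns `≤ g` (resp. `≥ g+1`) is
even, because both kinds of letters are exactly the steps leaving or entering the quadrant
`{x ≤ g, y ≤ j}` (resp. `{x ≥ g+1, y ≤ j}`). For a section with heights `y_1 < … < y_{2k}` of
the gap `g` no section line crosses the gap at the rows `y_1 ≤ j < y_{2k}` (they lie in one
page), so each such row has vertical bonds on both sides of the gap (`≥ 1 + 1`), and by parity an
even number `≥ 2 + 2` on the rows where the number of heights `≤ j` is even (the "outside gaps";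
the heights of the gap below `y_1` are even in number, being cut off by a crossing section line,
at which one side has no vertical bond). Summing over the `≥ 2k-1` rows, of which `≥ k-1` are of
the second kind (`card_filter_even_rankLE`), gives `≥ 2(2k-1) + 2(k-1) = 6k-4` vertical letters.

## References

* A. Rechnitzer, *Haruspicy 2*, J. Combin. Theory Ser. A 113 (2006) 520–546, §2.2, Lemma 10.
  [Rechnitzer2006Haruspicy2]
-/

noncomputable section

open Finset Literature.Probability.LatticeModels Literature.Probability.Percolation
open scoped BigOperators

namespace Literature.Barriers.CriticalPhenomena

namespace Haruspicy

open Edwards2D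

variable {w : List (Fin 4)}

/-! ### Parity of the number of changes along a sequence -/

/-- Along a sequence of truth values, the number of changes among the first `k` steps has the
parity of `[b 0 ≠ b k]`. [folklore] -/
theorem card_filter_ne_succ_mod_two (b : ℕ → Bool) (k : ℕ) :
    ((Finset.range k).filter fun i => b i ≠ b (i + 1)).card % 2 = if b 0 = b k then 0 else 1 := by
  induction k with
  | zero => simp
  | succ k ih =>
    rw [Finset.range_add_one, Finset.filter_insert]
    by_cases h : b k ≠ b (k + 1)
    · rw [if_pos h, Finset.card_insert_of_notMem (by simp), Nat.add_mod, ih]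
      cases h0 : b 0 <;> cases hk : b k <;> cases hk1 : b (k + 1) <;> simp_all
    · rw [if_neg h, ih]
      push Not at h
      rw [h]

/-! ### Letters leaving or entering a quadrant -/

/-- The horizontal letters across the gap `g` at heights `≤ j` (the horizontal bonds crossed by
the vertical line `x = g + ½` below the height `j + ½`). [folklore] -/
def hBelow (w : List (Fin 4)) (g j : ℤ) : Finset ℕ :=
  (Finset.range w.length).filter fun i =>
    (w.getD i 0).val < 2 ∧ gapOf (vtx w i 0) (w.getD i 0) = g ∧ vtx w i 1 ≤ j

/-- The vertical letters of row `j` in columns `≤ g` (the vertical bonds crossed by the section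
line of row `j` to the left of the gap `g`). [folklore] -/
def vLeft (w : List (Fin 4)) (g j : ℤ) : Finset ℕ :=
  (Finset.range w.length).filter fun i =>
    2 ≤ (w.getD i 0).val ∧ rowOf (vtx w i 1) (w.getD i 0) = j ∧ vtx w i 0 ≤ g

/-- The vertical letters of row `j` in columns `≥ g + 1` (those to the right of the gap `g`).
[folklore] -/
def vRight (w : List (Fin 4)) (g j : ℤ) : Finset ℕ :=
  (Finset.range w.length).filter fun i =>
    2 ≤ (w.getD i 0).val ∧ rowOf (vtx w i 1) (w.getD i 0) = j ∧ g + 1 ≤ vtx w i 0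

/-- **One step and the lower-left quadrant** `{x ≤ g, y ≤ j}`: the step `i` leaves or enters it
iff it is horizontal across the gap `g` at height `≤ j` or vertical in row `j` at a column `≤ g`.
[folklore] -/
theorem quadrantLL_step (w : List (Fin 4)) (g j : ℤ) {i : ℕ} (hi : i < w.length) :
    (¬ ((vtx w i 0 ≤ g ∧ vtx w i 1 ≤ j) ↔ (vtx w (i + 1) 0 ≤ g ∧ vtx w (i + 1) 1 ≤ j))) ↔
      ((w.getD i 0).val < 2 ∧ gapOf (vtx w i 0) (w.getD i 0) = g ∧ vtx w i 1 ≤ j) ∨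
        (2 ≤ (w.getD i 0).val ∧ rowOf (vtx w i 1) (w.getD i 0) = j ∧ vtx w i 0 ≤ g) := by
  rw [vtx_succ w hi, ← List.getD_eq_getElem w 0 hi]
  rcases fin4_cases (w.getD i 0) with h | h | h | h <;> rw [h] <;>
    simp [gapOf, rowOf, Pi.add_apply] <;> omega

/-- **One step and the lower-right quadrant** `{x ≥ g+1, y ≤ j}`. [folklore] -/
theorem quadrantLR_step (w : List (Fin 4)) (g j : ℤ) {i : ℕ} (hi : i < w.length) :
    (¬ ((g + 1 ≤ vtx w i 0 ∧ vtx w i 1 ≤ j) ↔ (g + 1 ≤ vtx w (i + 1) 0 ∧ vtx w (i + 1) 1 ≤ j))) ↔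
      ((w.getD i 0).val < 2 ∧ gapOf (vtx w i 0) (w.getD i 0) = g ∧ vtx w i 1 ≤ j) ∨
        (2 ≤ (w.getD i 0).val ∧ rowOf (vtx w i 1) (w.getD i 0) = j ∧ g + 1 ≤ vtx w i 0) := by
  rw [vtx_succ w hi, ← List.getD_eq_getElem w 0 hi]
  rcases fin4_cases (w.getD i 0) with h | h | h | h <;> rw [h] <;>
    simp [gapOf, rowOf, Pi.add_apply] <;> omega

/-- **Crossing parity, left**: for a closed word, the number of horizontal letters across the
gap `g` at heights `≤ j` plus the number of vertical letters of row `j` in columns `≤ g` is even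
(both are the steps across the boundary of the quadrant `{x ≤ g, y ≤ j}`). [folklore] -/
theorem even_card_hBelow_add_card_vLeft (hc : (w.map stepVec).sum = 0) (g j : ℤ) :
    Even ((hBelow w g j).card + (vLeft w g j).card) := by
  set b : ℕ → Bool := fun i => decide (vtx w i 0 ≤ g ∧ vtx w i 1 ≤ j) with hb
  have hunion : ((Finset.range w.length).filter fun i => b i ≠ b (i + 1)) =
      hBelow w g j ∪ vLeft w g j := by
    ext i
    simp only [Finset.mem_filter, Finset.mem_union, hBelow, vLeft, Finset.mem_range, hb, ne_eq,
      decide_eq_decide]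
    constructor
    · rintro ⟨hi, hne⟩
      rcases (quadrantLL_step w g j hi).1 hne with h | h
      · exact Or.inl ⟨hi, h⟩
      · exact Or.inr ⟨hi, h⟩
    · rintro (⟨hi, h⟩ | ⟨hi, h⟩)
      · exact ⟨hi, (quadrantLL_step w g j hi).2 (Or.inl h)⟩
      · exact ⟨hi, (quadrantLL_step w g j hi).2 (Or.inr h)⟩
  have hdisj : Disjoint (hBelow w g j) (vLeft w g j) := by
    rw [hBelow, vLeft, Finset.disjoint_filter]
    rintro i - ⟨h1, -⟩ ⟨h2, -⟩
    omega
  have hcard := card_filter_ne_succ_mod_two b w.length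
  have h0 : b 0 = b w.length := by
    simp only [hb, vtx_zero, vtx_length, hc]
  rw [hunion, Finset.card_union_of_disjoint hdisj, if_pos h0] at hcard
  exact Nat.even_iff.2 hcard

/-- **Crossing parity, right**: the same with the vertical letters of row `j` in columns
`≥ g+1` (the quadrant `{x ≥ g+1, y ≤ j}`). [folklore] -/
theorem even_card_hBelow_add_card_vRight (hc : (w.map stepVec).sum = 0) (g j : ℤ) :
    Even ((hBelow w g j).card + (vRight w g j).card) := by
  set b : ℕ → Bool := fun i => decide (g + 1 ≤ vtx w i 0 ∧ vtx w i 1 ≤ j) with hb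
  have hunion : ((Finset.range w.length).filter fun i => b i ≠ b (i + 1)) =
      hBelow w g j ∪ vRight w g j := by
    ext i
    simp only [Finset.mem_filter, Finset.mem_union, hBelow, vRight, Finset.mem_range, hb, ne_eq,
      decide_eq_decide]
    constructor
    · rintro ⟨hi, hne⟩
      rcases (quadrantLR_step w g j hi).1 hne with h | h
      · exact Or.inl ⟨hi, h⟩
      · exact Or.inr ⟨hi, h⟩
    · rintro (⟨hi, h⟩ | ⟨hi, h⟩)
      · exact ⟨hi, (quadrantLR_step w g j hi).2 (Or.inl h)⟩
      · exact ⟨hi, (quadrantLR_step w g j hi).2 (Or.inr h)⟩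
  have hdisj : Disjoint (hBelow w g j) (vRight w g j) := by
    rw [hBelow, vRight, Finset.disjoint_filter]
    rintro i - ⟨h1, -⟩ ⟨h2, -⟩
    omega
  have hcard := card_filter_ne_succ_mod_two b w.length
  have h0 : b 0 = b w.length := by
    simp only [hb, vtx_zero, vtx_length, hc]
  rw [hunion, Finset.card_union_of_disjoint hdisj, if_pos h0] at hcard
  exact Nat.even_iff.2 hcard

/-! ### The counts in terms of bonds -/

/-- For a SAP word the horizontal letters across `g` at heights `≤ j` are as many as the heights
`≤ j` of the gap `g` (edge simplicity, `IsSAP.eq_of_gap_eq`). [folklore] -/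
theorem IsSAP.card_hBelow (h : IsSAP w) (g j : ℤ) :
    (hBelow w g j).card = ((gapHeights w g).filter fun y => y ≤ j).card := by
  rw [gapHeights, Finset.filter_image]
  symm
  have hset : ((Finset.range w.length).filter fun i =>
      (w.getD i 0).val < 2 ∧ gapOf (vtx w i 0) (w.getD i 0) = g).filter (fun i => vtx w i 1 ≤ j) =
      hBelow w g j := by
    rw [hBelow, Finset.filter_filter]
    exact Finset.filter_congr fun i _ => by rw [and_assoc]
  rw [hset]
  refine Finset.card_image_of_injOn fun i hi i' hi' heq => ?_
  simp only [Finset.coe_filter, hBelow, Set.mem_setOf_eq, Finset.mem_range] at hi hi'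
  exact h.eq_of_gap_eq hi.1 hi'.1 hi.2.1 hi'.2.1 (hi.2.2.1.trans hi'.2.2.1.symm) heq

/-- Row `j` has a vertical bond in a column `≤ g` iff `vLeft w g j` is non-empty. [folklore] -/
theorem vLeft_nonempty_iff {g j : ℤ} : (vLeft w g j).Nonempty ↔ ∃ c ∈ rowCols w j, c ≤ g := by
  constructor
  · rintro ⟨i, hi⟩
    simp only [vLeft, Finset.mem_filter, Finset.mem_range] at hi
    exact ⟨vtx w i 0, mem_rowCols.2 ⟨i, hi.1, hi.2.1, hi.2.2.1, rfl⟩, hi.2.2.2⟩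
  · rintro ⟨c, hc, hcg⟩
    obtain ⟨i, hi, hv, hr, rfl⟩ := mem_rowCols.1 hc
    exact ⟨i, by simp only [vLeft, Finset.mem_filter, Finset.mem_range]; exact ⟨hi, hv, hr, hcg⟩⟩

/-- Row `j` has a vertical bond in a column `≥ g+1` iff `vRight w g j` is non-empty. [folklore] -/
theorem vRight_nonempty_iff {g j : ℤ} :
    (vRight w g j).Nonempty ↔ ∃ c ∈ rowCols w j, g + 1 ≤ c := by
  constructor
  · rintro ⟨i, hi⟩
    simp only [vRight, Finset.mem_filter, Finset.mem_range] at hi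
    exact ⟨vtx w i 0, mem_rowCols.2 ⟨i, hi.1, hi.2.1, hi.2.2.1, rfl⟩, hi.2.2.2⟩
  · rintro ⟨c, hc, hcg⟩
    obtain ⟨i, hi, hv, hr, rfl⟩ := mem_rowCols.1 hc
    exact ⟨i, by simp only [vRight, Finset.mem_filter, Finset.mem_range]; exact ⟨hi, hv, hr, hcg⟩⟩

/-- A row not crossed from the left has a vertical bond to the left of the gap. [folklore] -/
theorem vLeft_nonempty_of_not_crossL {g j : ℤ} (h : ¬ CrossL w g j) : (vLeft w g j).Nonempty := by
  rw [vLeft_nonempty_iff]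
  unfold CrossL at h
  push Not at h
  obtain ⟨c, hc, hlt⟩ := h
  exact ⟨c, hc, by omega⟩

/-- A row not crossed from the right has a vertical bond to the right of the gap. [folklore] -/
theorem vRight_nonempty_of_not_crossR {g j : ℤ} (h : ¬ CrossR w g j) :
    (vRight w g j).Nonempty := by
  rw [vRight_nonempty_iff]
  unfold CrossR at h
  push Not at h
  obtain ⟨c, hc, hlt⟩ := h
  exact ⟨c, hc, by omega⟩

/-- A row crossed from the left has no vertical bond to the left of the gap. [folklore] -/
theorem vLeft_eq_empty_of_crossL {g j : ℤ} (h : CrossL w g j) : vLeft w g j = ∅ := by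
  by_contra hne
  obtain ⟨c, hc, hcg⟩ := vLeft_nonempty_iff.1 (Finset.nonempty_iff_ne_empty.2 hne)
  have := h c hc
  omega

/-- A row crossed from the right has no vertical bond to the right of the gap. [folklore] -/
theorem vRight_eq_empty_of_crossR {g j : ℤ} (h : CrossR w g j) : vRight w g j = ∅ := by
  by_contra hne
  obtain ⟨c, hc, hcg⟩ := vRight_nonempty_iff.1 (Finset.nonempty_iff_ne_empty.2 hne)
  have := h c hc
  omega

/-- **The vertical letters of distinct rows, left and right of a gap, are distinct**: their
number summed over any finite set of rows is at most `vcount w`. [folklore] -/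
theorem sum_card_vLeft_add_card_vRight_le (w : List (Fin 4)) (g : ℤ) (J : Finset ℤ) :
    ∑ j ∈ J, ((vLeft w g j).card + (vRight w g j).card) ≤ vcount w := by
  classical
  have hdisjLR : ∀ j, Disjoint (vLeft w g j) (vRight w g j) := fun j => by
    rw [vLeft, vRight, Finset.disjoint_filter]
    rintro i - ⟨-, -, h1⟩ ⟨-, -, h2⟩
    omega
  have hdisj : ∀ j ∈ J, ∀ j' ∈ J, j ≠ j' →
      Disjoint (vLeft w g j ∪ vRight w g j) (vLeft w g j' ∪ vRight w g j') := by
    intro j _ j' _ hne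
    rw [Finset.disjoint_left]
    intro i hi hi'
    simp only [vLeft, vRight, Finset.mem_union, Finset.mem_filter] at hi hi'
    have h1 : rowOf (vtx w i 1) (w.getD i 0) = j := by
      rcases hi with h | h <;> exact h.2.2.1
    have h2 : rowOf (vtx w i 1) (w.getD i 0) = j' := by
      rcases hi' with h | h <;> exact h.2.2.1
    exact hne (h1.symm.trans h2)
  have hsum : ∑ j ∈ J, ((vLeft w g j).card + (vRight w g j).card) =
      (J.biUnion fun j => vLeft w g j ∪ vRight w g j).card := by
    rw [Finset.card_biUnion hdisj]
    exact Finset.sum_congr rfl fun j _ => (Finset.card_union_of_disjoint (hdisjLR j)).symm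
  rw [hsum, ← card_filter_vertical]
  refine Finset.card_le_card fun i hi => ?_
  simp only [Finset.mem_biUnion, Finset.mem_union, vLeft, vRight, Finset.mem_filter] at hi
  obtain ⟨j, -, h | h⟩ := hi <;> exact Finset.mem_filter.2 ⟨h.1, h.2.1⟩

/-! ### A counting lemma: rows of even rank -/

/-- The number of elements of `Y` that are `≤ j` (the rank of the row `j`). [folklore] -/
def rankLE (Y : Finset ℤ) (j : ℤ) : ℕ := (Y.filter fun y => y ≤ j).card

/-- **Rows of even rank**: between the least and the largest element of a finite set `Y ⊂ ℤ`
with `m` elements there are at least `⌊(m-1)/2⌋` rows `[j, j+1]` such that the number of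
elements `≤ j` is even (the rows just above the 2nd, 4th, … , `(m-2)`-nd or `(m-1)`-st element).
[folklore] -/
theorem card_filter_even_rankLE (Y : Finset ℤ) (hY : Y.Nonempty) :
    (Y.card - 1) / 2 ≤
      ((Finset.Ico (Y.min' hY) (Y.max' hY)).filter fun j => Even (rankLE Y j)).card := by
  induction Y using Finset.induction_on_max with
  | empty => exact absurd hY Finset.not_nonempty_empty
  | insert a s ha ih =>
    rcases s.eq_empty_or_nonempty with rfl | hs
    · simp
    have hb : s.max' hs < a := ha _ (Finset.max'_mem s hs)
    have hmin : (insert a s).min' hY = s.min' hs := by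
      rw [Finset.min'_insert a s hs]
      exact min_eq_right ((Finset.min'_le s _ (Finset.max'_mem s hs)).trans hb.le)
    have hmax : (insert a s).max' hY = a := by
      rw [Finset.max'_insert a s hs]
      exact max_eq_left hb.le
    have has : a ∉ s := fun h => lt_irrefl a (ha a h)
    rw [hmin, hmax, Finset.card_insert_of_notMem has, Nat.add_sub_cancel]
    -- split the rows at the old maximum
    have hsplit : Finset.Ico (s.min' hs) a =
        Finset.Ico (s.min' hs) (s.max' hs) ∪ Finset.Ico (s.max' hs) a :=
      (Finset.Ico_union_Ico_eq_Ico (Finset.min'_le s _ (Finset.max'_mem s hs)) hb.le).symm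
    rw [hsplit, Finset.filter_union,
      Finset.card_union_of_disjoint (Finset.disjoint_filter_filter
        (Finset.Ico_disjoint_Ico_consecutive _ _ _))]
    -- below the old maximum the ranks are unchanged
    have hlow : ((Finset.Ico (s.min' hs) (s.max' hs)).filter fun j => Even (rankLE (insert a s) j)) =
        ((Finset.Ico (s.min' hs) (s.max' hs)).filter fun j => Even (rankLE s j)) := by
      refine Finset.filter_congr fun j hj => ?_
      rw [Finset.mem_Ico] at hj
      rw [rankLE, rankLE, Finset.filter_insert, if_neg (by omega)]
    -- above it the rank is `#s`
    have hhigh : ∀ j ∈ Finset.Ico (s.max' hs) a, rankLE (insert a s) j = s.card := by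
      intro j hj
      rw [Finset.mem_Ico] at hj
      rw [rankLE, Finset.filter_insert, if_neg (by omega)]
      congr 1
      exact Finset.filter_true_of_mem fun y hy => (Finset.le_max' s y hy).trans hj.1
    rw [hlow]
    have ih' := ih hs
    by_cases he : Even s.card
    · have hall : ((Finset.Ico (s.max' hs) a).filter fun j => Even (rankLE (insert a s) j)) =
          Finset.Ico (s.max' hs) a :=
        Finset.filter_true_of_mem fun j hj => by rw [hhigh j hj]; exact he
      rw [hall, Int.card_Ico]
      have h1 : 1 ≤ (a - s.max' hs).toNat := by omega
      obtain ⟨c, hc⟩ := he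
      omega
    · have : (s.card - 1) / 2 = s.card / 2 := by
        rw [Nat.even_iff] at he
        omega
      omega

/-- A finite set of integers with `m` elements spans at least `m - 1` rows. [folklore] -/
theorem card_sub_one_le_card_Ico (Y : Finset ℤ) (hY : Y.Nonempty) :
    Y.card - 1 ≤ (Finset.Ico (Y.min' hY) (Y.max' hY)).card := by
  have hsub : Y ⊆ Finset.Icc (Y.min' hY) (Y.max' hY) := fun y hy =>
    Finset.mem_Icc.2 ⟨Finset.min'_le Y y hy, Finset.le_max' Y y hy⟩
  have h1 := Finset.card_le_card hsub
  rw [Int.card_Icc] at h1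
  rw [Int.card_Ico]
  have h2 : Y.min' hY ≤ Y.max' hY := Finset.min'_le Y _ (Finset.max'_mem Y hY)
  omega

/-! ### Lemma 10 -/

/-- **The rows of a section carry vertical bonds on both sides of its gap, an even number on
rows of even rank.** For a section of a SAP word across the gap `g` with height set `Y` (least
height `y`, largest `b`) and a row `y ≤ j < b`: no section line crosses the gap at `j`, and the
numbers of vertical letters of row `j` left and right of the gap are positive and congruent
mod `2` to the number of heights of `Y` that are `≤ j`.
[cite: Rechnitzer2006Haruspicy2, Lemma 10 (proof)] -/
theorem IsSAP.two_add_le_card_vLeft_add_card_vRight (h : IsSAP w) {g y : ℤ} (hl : IsLeader w g y)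
    {j : ℤ} (hyj : y ≤ j) (hjb : ∃ b ∈ secHeights w g y, j < b) :
    2 + (if Even (rankLE (secHeights w g y) j) then 2 else 0) ≤
      (vLeft w g j).card + (vRight w g j).card := by
  classical
  obtain ⟨b, hb, hjb⟩ := hjb
  have hbY := mem_secHeights.1 hb
  -- no section line crosses the gap at the row `j`
  have hncross : ¬ Crosses w g j := fun hc => hbY.2.2 ⟨j, hyj, hjb, hc⟩
  have hL : 1 ≤ (vLeft w g j).card :=
    Finset.card_pos.2 (vLeft_nonempty_of_not_crossL fun hc => hncross (Or.inl hc))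
  have hR : 1 ≤ (vRight w g j).card :=
    Finset.card_pos.2 (vRight_nonempty_of_not_crossR fun hc => hncross (Or.inr hc))
  -- the heights of the gap `≤ j` are those below `y` and those of the section `≤ j`
  set low := (gapHeights w g).filter fun y' => y' < y with hlow
  have hsplit : ((gapHeights w g).filter fun y' => y' ≤ j) =
      low ∪ (secHeights w g y).filter fun y' => y' ≤ j := by
    ext y'
    simp only [hlow, Finset.mem_union, Finset.mem_filter, mem_secHeights]
    constructor
    · rintro ⟨hy', hle⟩
      by_cases hlt : y' < y
      · exact Or.inl ⟨hy', hlt⟩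
      · refine Or.inr ⟨⟨hy', not_lt.1 hlt, ?_⟩, hle⟩
        rintro ⟨j', h1, h2, h3⟩
        exact hbY.2.2 ⟨j', h1, by omega, h3⟩
    · rintro (⟨hy', hlt⟩ | ⟨⟨hy', -, -⟩, hle⟩)
      · exact ⟨hy', by omega⟩
      · exact ⟨hy', hle⟩
  have hdisj : Disjoint low ((secHeights w g y).filter fun y' => y' ≤ j) := by
    rw [Finset.disjoint_left]
    intro y' h1 h2
    rw [hlow, Finset.mem_filter] at h1
    rw [Finset.mem_filter, mem_secHeights] at h2
    omega
  have hcount : (hBelow w g j).card = low.card + rankLE (secHeights w g y) j := by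
    rw [h.card_hBelow, hsplit, Finset.card_union_of_disjoint hdisj, rankLE]
  -- the heights below `y` are even in number: they end at a crossing section line
  have hlow_even : Even low.card := by
    rcases low.eq_empty_or_nonempty with he | hne
    · rw [he]; exact ⟨0, rfl⟩
    set y₀ := low.max' hne
    have hy₀ : y₀ ∈ low := Finset.max'_mem _ _
    rw [hlow, Finset.mem_filter] at hy₀
    obtain ⟨j₀, h1, h2, hcross⟩ := hl.2 y₀ hy₀.1 hy₀.2
    have hcount₀ : (hBelow w g j₀).card = low.card := by
      rw [h.card_hBelow]
      congr 1
      ext y'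
      simp only [Finset.mem_filter, hlow]
      constructor
      · rintro ⟨hy', hle⟩; exact ⟨hy', by omega⟩
      · rintro ⟨hy', hlt⟩
        have : y' ≤ y₀ := Finset.le_max' low y' (by rw [hlow, Finset.mem_filter]; exact ⟨hy', hlt⟩)
        exact ⟨hy', this.trans h1⟩
    rcases hcross with hc | hc
    · have := even_card_hBelow_add_card_vLeft h.2.1 g j₀
      rwa [vLeft_eq_empty_of_crossL hc, Finset.card_empty, add_zero, hcount₀] at this
    · have := even_card_hBelow_add_card_vRight h.2.1 g j₀
      rwa [vRight_eq_empty_of_crossR hc, Finset.card_empty, add_zero, hcount₀] at this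
  -- parities of the two sides
  have hpL := even_card_hBelow_add_card_vLeft h.2.1 g j
  have hpR := even_card_hBelow_add_card_vRight h.2.1 g j
  rw [hcount] at hpL hpR
  obtain ⟨c₀, hc₀⟩ := hlow_even
  rw [Nat.even_iff] at hpL hpR
  split_ifs with he
  · obtain ⟨r, hr⟩ := he
    omega
  · omega

end Haruspicy

open Haruspicy

/-- **Rechnitzer 2006, Lemma 10, PROVED** (discharge of `Rechnitzer2006_lem10`): a canonical
polygon word with a `k`-section (`2k` horizontal bonds across one gap within one page), `k ≥ 1`,
has at least `6k-4` vertical letters. Proof as printed, with the crossing parity of the closed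
walk w.r.t. quadrants standing in for "inside"/"outside": every row between the least and the
largest height of the section has vertical bonds on both sides of the gap, and an even number
(so `≥ 2`) on each side at the `≥ k-1` rows of even rank; `2(2k-1) + 2(k-1) = 6k-4`.
[cite: Rechnitzer2006Haruspicy2, Lemma 10] -/
theorem Rechnitzer2006_lem10_holds : Rechnitzer2006_lem10 := by
  classical
  intro w hw k hk hex
  obtain ⟨⟨g, y⟩, hs, hcard⟩ := hex
  dsimp only at hcard
  have hsap : IsSAP w := hw.1
  have hl : IsLeader w g y := (mem_sections (p := (g, y))).1 hs
  have hyY : y ∈ secHeights w g y := hl.mem_secHeights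
  have hne : (secHeights w g y).Nonempty := ⟨y, hyY⟩
  have hmin : (secHeights w g y).min' hne = y :=
    le_antisymm (Finset.min'_le _ y hyY)
      (Finset.le_min' _ hne y fun y' hy' => (mem_secHeights.1 hy').2.1)
  -- the bound on each row `y ≤ j < max`, summed
  have hrow : ∀ j ∈ Finset.Ico ((secHeights w g y).min' hne) ((secHeights w g y).max' hne),
      2 + (if Even (rankLE (secHeights w g y) j) then 2 else 0) ≤
        (vLeft w g j).card + (vRight w g j).card := by
    intro j hj
    rw [Finset.mem_Ico, hmin] at hj
    exact hsap.two_add_le_card_vLeft_add_card_vRight hl hj.1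
      ⟨(secHeights w g y).max' hne, Finset.max'_mem _ hne, hj.2⟩
  have hsum := Finset.sum_le_sum hrow
  rw [Finset.sum_add_distrib, Finset.sum_const, smul_eq_mul, ← Finset.sum_filter,
    Finset.sum_const, smul_eq_mul] at hsum
  have htot := sum_card_vLeft_add_card_vRight_le w g
    (Finset.Ico ((secHeights w g y).min' hne) ((secHeights w g y).max' hne))
  have hJ := card_sub_one_le_card_Ico (secHeights w g y) hne
  have hE := card_filter_even_rankLE (secHeights w g y) hne
  simp only [hcard] at hJ hE
  have hk1 : (2 * k - 1) / 2 = k - 1 := by omega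
  rw [hk1] at hE
  -- `vcount ≥ 2 #rows + 2 #(rows of even rank) ≥ 2(2k-1) + 2(k-1) = 6k - 4`
  have hfin := hsum.trans htot
  omega

end Literature.Barriers.CriticalPhenomena
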